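import Literature.MathematicalPhysics.QuantumFieldTheory.Balaban1983to89.B8Eq159TorusPerOfSockB9P3
import Literature.MathematicalPhysics.QuantumFieldTheory.Balaban1983to89.B8LeafModelZd3SockPer

/-!
# `Balaban1983to89.B8Eq159TorusPerOfSockB9P3Per` — T. Bałaban, *Spaces of regular gauge field configurations on a lattice and gauge fixing
# conditions*, Commun. Math. Phys. **99** (1985) 75–102 [Balaban1985RegularSpaces], (1.59) p. 86 ON THE TORUS, GUARDED EDITION: the displayed
# (B)-line `B9P3PerAt` of the M5.9 knit at a PERIODIC background IS the periodic-guarded `ℤᵈ` b9-socket `SockB9P3Per P` read at the torus member —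
# the twin of `B8Eq159TorusPerOfSockB9P3` (p637562) with the three periodicity threads `U₀`, `W`, `A′` CONSUMED instead of discarded

statement-level skeleton of published theorems with citation tags; proofs where landed; nothing here is a claim about the Yang–Mills mass gap

PDF held: `paper:balaban1985-cmp99-regular-spaces-gauge-fixing` (journal page = PDF page + 74); p. 86 [PDF 12] read AS AN IMAGE this session (render
`run/shared/lean/pub/pub-balaban/b2b-balaban-ref1/pages/1985-cmp99-regular-spaces-gauge-fixing/1985-cmp99-regular-spaces-gauge-fixing-p012-x2.png`),
p. 77 [PDF 3] (*"we admit the case where some domains Ω_j are equal to T_η"*); [4] = T. Bałaban, *Propagators for lattice gauge theories in a background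
field*, Commun. Math. Phys. **99** (1985) 389–434 [Balaban1985BackgroundPropagators], Thm 3.3 p. 399 (the source of (1.59), through the socket's suppliers).

CITATION HEADER (lean-in-tree rule).  Cell `lit-balaban`, seat `lit-balaban-r05` (gen 86; [B8] block owner, B-LINE A author), sub-row G-B8-T2S; lead g32
RULING #9 ADDENDUM (2026-08-28T14:04Z, lit-balaban word #27 (2)(a)): *"the hour `SockB9P3Per` lands, file the guarded twin `B8Eq159TorusPerOfSockB9P3Per` —
`b9P3PerAt_of_sockB9P3Per` (one datum; `IsPeriodic P U₀` as an added hypothesis, W∕A′ guards discharged by `B9P3PerAt`'s own binders) +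
`b9Arrow_of_sockB9P3Per_family` (the exact `hb9` binder shape of `hThm2_of_core`, where U₀ is periodic by hypothesis) — B-LINE A's proof with three
`IsPeriodic` threads, nothing else"*; R3 `stmt-QuantumFields-19200`, helper.  REUSED BY NAME: `B8Thm2TorusKnitEstimatesOfMajorants.B9P3PerAt` (t2s-1, M5.9
file A4), `B8LeafModelZd3SockPer.SockB9P3Per ∕ sockB9P3Per_apply_dir ∕ sockB9P3Per_anti ∕ sockB9P3Per_of_sockB9P3` (cell `pub-ymgap`, dag-n06-b g22: the
GUARDED socket and its per-direction adapter — the bridge `∀ z i, F (z + P•e_i) = F z ⟹ T4TermwiseTorus.IsPeriodic P F` is theirs ∕ P1's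
`B8LeafModelZdPer.isPeriodic_iff_shiftCfg`, not re-proved here), `B8Thm2TorusMember.torusIdx ∕ torusLamb` (p33), `B8Thm4TorusAt.torusLam`,
`B8LeafModelZd.ZdIdx`, and §1 of the unguarded twin `B8Eq159TorusPerOfSockB9P3` (r05, p637562) for the corollary «unguarded ⟹ guarded».

WHAT IS PRINTED (verbatim, p. 86 [PDF 12]).  *"Theorem 3.3 of [4] implies the bounds: |A|₍₋₁₎, |∇^η_{U₀}A|₍₋₂₎, |D^{η*}_{U₀}D^η_{U₀}A|₍₋₃₎, |Δ^η_{U₀}A|₍₋₃₎ ≦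
B₀(|J|₍₋₃₎ + |B₁|) (1.59)"*; Prop. 3 p. 87: *"where B₀, B₀(β₀) are the corresponding norms of the operators G(U₀), H(U₀), and depend on d and L only, B₀(β₀)
on β₀ also"*; p. 77: *"we admit the case where some domains Ω_j are equal to T_η"* — the configurations of Theorem 2 on `T_η` are fields on the finite torus,
i.e. `P`-periodic fields on `ℤᵈ` (the reading of the whole sub-row G-B8-T2S and of cell `pub-ymgap`'s periodic road R4∕N05 (β′)).

WHY THIS FILE.  The (B)-arrow of the endpoint of record `B8Thm2TorusKnitCubeCore.hThm2_of_core` (t2s-1, p635808 ✓; reduced form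
`B8Thm2TorusB9LineReduced.hThm2_of_core_three`, p638069 ✓) asks, per member and truncation `m′`, for `B9P3PerAt L B₀ B₀β c_B β len η m′ α₀ P U₀` at
`SU(N)`-valued **`P`-periodic** backgrounds `U₀ ∈ 𝔄_{m′}(T_η, α₀)`; and `B9P3PerAt` itself quantifies over **`P`-periodic** unitary `W` and **`P`-periodic**
Hermitian `A′` (its displayed binders `∀ z i, W (z + P • e i) = W z`, `∀ z i, A′ (z + P • e i) = A′ z`).  The unguarded twin (p637562) fed this from the
UNGUARDED socket `B8LeafModelZd3.SockB9P3` at `Ω₀ = ℤ^{d+1}` — but cell `pub-ymgap`'s node N06 can supply [4]'s operators `G(U₀)`, `R(U₀)`, `Q*` only on the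
FINITE-dimensional periodic data (dag-n06-b g22 WORD-26; dag-n05-d JUNCTION NOTE v2 (3): the unguarded socket at `Ω₀ = univ` is [4] in infinite volume,
unsuppliable), whence the GUARDED socket `B8LeafModelZd3SockPer.SockB9P3Per P …` = `SockB9P3`'s text behind `IsPeriodic P U₀ → IsPeriodic P W → … →
IsPeriodic P A′ →`.  THIS FILE is the lit-balaban side of that junction: at the torus member (`Ω_j := ℤ^{d+1}`, `Λs := torusLam`, `Λb := torusLamb`) the
GUARDED socket IS the (B)-line at every `P`-periodic unitary background — the `U₀`-guard is the arrow's own hypothesis, the `W`- and `A′`-guards are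
`B9P3PerAt`'s own binders (read through dag-n06-b's per-direction adapter `sockB9P3Per_apply_dir`).  §1: one datum (general `𝔸`; `SU(N)`; at p33's
`torusIdx t`; and ★ `b9Arrow_of_sockB9P3Per` — the (B)-arrow in the EXACT binder shape of `hThm2_of_core` from the guarded socket at all truncations
`m′ ≤ k` of ONE torus, the hypothesis shape file A17 displays per RULING #9 ADDENDUM (2)(b)); §2: from a family conclusion over all `ℤ^{d+1}` data
(`∀ i : ZdIdx, ∀ m ≤ i.k, SockB9P3Per P …`, the shape of a datum-generic supplier) — ★ `b9Arrow_of_sockB9P3Per_family`; §3: corollary — the unguarded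
socket feeds the guarded arrow (`sockB9P3Per_of_sockB9P3`), so p637562's consumers lose nothing.  PERIOD CONVENTION: the knit binds the period as an
integer instantiated by a natural cast (`(((PV 2 ℓ F.m K _ _).sitesPerDir 0 : ℕ) : ℤ)`, A16 :321); the socket's guards use `T4TermwiseTorus.IsPeriodic (P : ℕ)`;
so every statement here takes `P : ℕ` and concludes `B9P3PerAt … (P : ℤ) U₀`.

HONEST SCOPE.  Adapters only (β-reduction of `Ω := fun _ ↦ univ`, `Λs := torusLam`, `Λb := torusLamb`; SU ⊂ U; threshold monotonicity; the three
periodicity threads): NO estimate of [B8] ∕ [4] is proved here, and the guarded socket itself is NOT discharged here (cell `pub-ymgap`'s node N06, periodic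
road: `B9Eq327GreenZdHermPer` ✓, `B9Eq321LandauProjectionZdPer`, `B9Eq326DeltaAPeriodicLettersZd`, … — in flight).  Count-neutral; `stub_PV3A` ∕
`stmt-QuantumFields-19200` ∕ N05 NOT discharged; nothing continuum ∕ ℝ⁴ ∕ OS ∕ mass-gap ∕ Clay — the Yang–Mills mass gap is NOT proved by any of this
(Track A conditional rung).  No `sorry`, no `def`, no `… : Prop` fact, no `instance`, no `notation`.  NEW file; nothing landed is modified.
Seat `lit-balaban-r05` gen 86, 2026-08-28.
-/

noncomputable section

namespace Literature.MathematicalPhysics.QuantumFieldTheory.Balaban1983to89.B8Eq159TorusPerOfSockB9P3Per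

open B7Prop1Explicit renaming Site → LSite
open B7Prop1Explicit (e)
open B7Prop2Explicit (unitaryUnits)
open scoped Matrix Matrix.Norms.L2Operator
open B7Prop2SpecialUnitary (specialUnitaryUnits specialUnitaryUnits_le_unitaryUnits)
open B8LeafModelZd (ZdIdx)
open B8LeafModelZd3 (SockB9P3)
open B8LeafModelZd3SockPer (SockB9P3Per sockB9P3Per_apply_dir sockB9P3Per_of_sockB9P3)
open B8Thm4TorusAt (torusLam)
open B8Thm2TorusMember (TorusMember torusLamb torusIdx)
open B8Thm2TorusKnitEstimatesOfMajorants (B9P3PerAt)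

variable {d : ℕ}

/-! ## §1 At one torus datum: the GUARDED socket IS the (B)-line at a periodic background -/

section OneDatum

variable {𝔸 : Type} [CStarAlgebra 𝔸]

/-- ★ **THE GUARDED `ℤᵈ` b9-SOCKET AT THE TORUS DATUM IS THE DISPLAYED (B)-LINE AT A PERIODIC BACKGROUND**: `SockB9P3Per P` at `Ω := ℤ^{d+1}` (every
level), `Λs := torusLam`, `Λb := torusLamb`, spacing `η`, truncation `m`, threshold `cP` gives `B9P3PerAt … η m α₀ P U₀` for every `P`-PERIODIC unitary `U₀`,
every `0 < α₀ ≤ cP` and every inner threshold `cB ≤ cP` — the `W`- and `A′`-guards of the socket are `B9P3PerAt`'s own periodicity binders (per-direction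
form, through `sockB9P3Per_apply_dir`). [cite: Balaban1985RegularSpaces, (1.59) p.86, Prop. 3 p.87, p.77 («Ω_j = T_η» admitted)] -/
theorem b9P3PerAt_of_sockB9P3Per {P : ℕ} {L : ℕ} {B₀ B₀β cP cB β : ℝ} {len : LSite (d + 1) → ℝ} {η : ℝ} {m : ℕ} {α₀ : ℝ}
    {U₀ : LSite (d + 1) → Fin (d + 1) → 𝔸ˣ}
    (hS : SockB9P3Per (𝔸 := 𝔸) P L B₀ B₀β cP β len η m (fun _ => (Set.univ : Set (LSite (d + 1))))
      (fun m' => torusLam (d := d + 1) m') (fun m' => torusLamb (d := d + 1) m'))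
    (hU₀ : ∀ x κ, U₀ x κ ∈ unitaryUnits 𝔸) (hU₀p : ∀ (z : LSite (d + 1)) (i : Fin (d + 1)), U₀ (z + (P : ℤ) • e i) = U₀ z)
    (hα₀ : 0 < α₀) (hα₀c : α₀ ≤ cP) (hcB : cB ≤ cP) :
    B9P3PerAt (𝔸 := 𝔸) L B₀ B₀β cB β len η m α₀ (P : ℤ) U₀ := by
  intro α₂ hα₂ hα₂c W hWu hWp hIn hInW hLan A' hA' hA'p h41 h0
  exact sockB9P3Per_apply_dir hS hα₀ hα₀c hα₂ (hα₂c.trans hcB) hU₀ hWu hU₀p hWp hIn hInW hLan hA' hA'p h41 h0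

/-- The same at an `SU(N)`-valued periodic background (the knit's currency). [cite: Balaban1985RegularSpaces, (1.59) p.86, Thm 2 p.83 (G ⊂ SU(N))] -/
theorem b9P3PerAt_of_sockB9P3Per_su {N : ℕ} {P : ℕ} {L : ℕ} {B₀ B₀β cP cB β : ℝ} {len : LSite (d + 1) → ℝ} {η : ℝ} {m : ℕ} {α₀ : ℝ}
    {U₀ : LSite (d + 1) → Fin (d + 1) → (Matrix (Fin N) (Fin N) ℂ)ˣ}
    (hS : letI : CStarAlgebra (Matrix (Fin N) (Fin N) ℂ) := {}
      SockB9P3Per (𝔸 := Matrix (Fin N) (Fin N) ℂ) P L B₀ B₀β cP β len η m (fun _ => (Set.univ : Set (LSite (d + 1))))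
        (fun m' => torusLam (d := d + 1) m') (fun m' => torusLamb (d := d + 1) m'))
    (hU₀ : ∀ x κ, U₀ x κ ∈ specialUnitaryUnits (Fin N)) (hU₀p : ∀ (z : LSite (d + 1)) (i : Fin (d + 1)), U₀ (z + (P : ℤ) • e i) = U₀ z)
    (hα₀ : 0 < α₀) (hα₀c : α₀ ≤ cP) (hcB : cB ≤ cP) :
    letI : CStarAlgebra (Matrix (Fin N) (Fin N) ℂ) := {}
    B9P3PerAt (𝔸 := Matrix (Fin N) (Fin N) ℂ) L B₀ B₀β cB β len η m α₀ (P : ℤ) U₀ :=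
  letI : CStarAlgebra (Matrix (Fin N) (Fin N) ℂ) := {}
  b9P3PerAt_of_sockB9P3Per hS (fun x κ => specialUnitaryUnits_le_unitaryUnits (hU₀ x κ)) hU₀p hα₀ hα₀c hcB

/-- **FROM THE TORUS MEMBER `torusIdx`**: the guarded socket at p33's torus datum `torusIdx hL t` and a level `m` is literally the guarded socket of
`b9P3PerAt_of_sockB9P3Per`. [cite: Balaban1985RegularSpaces, (1.59) p.86, p.77] -/
theorem b9P3PerAt_of_sockB9P3Per_torusIdx {P : ℕ} {L : ℕ} (hL : 1 ≤ L) {B₀ B₀β cP cB β : ℝ} {len : LSite (d + 1) → ℝ} (t : TorusMember)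
    {m : ℕ} {α₀ : ℝ} {U₀ : LSite (d + 1) → Fin (d + 1) → 𝔸ˣ}
    (hS : SockB9P3Per (𝔸 := 𝔸) P L B₀ B₀β cP β len (torusIdx (d := d + 1) hL t).η m (torusIdx (d := d + 1) hL t).Ω
      (torusIdx (d := d + 1) hL t).Λs (torusIdx (d := d + 1) hL t).Λb)
    (hU₀ : ∀ x κ, U₀ x κ ∈ unitaryUnits 𝔸) (hU₀p : ∀ (z : LSite (d + 1)) (i : Fin (d + 1)), U₀ (z + (P : ℤ) • e i) = U₀ z)
    (hα₀ : 0 < α₀) (hα₀c : α₀ ≤ cP) (hcB : cB ≤ cP) :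
    B9P3PerAt (𝔸 := 𝔸) L B₀ B₀β cB β len t.η m α₀ (P : ℤ) U₀ :=
  b9P3PerAt_of_sockB9P3Per hS hU₀ hU₀p hα₀ hα₀c hcB

/-- ★ **THE (B)-ARROW OF `hThm2_of_core` FROM THE GUARDED SOCKET AT ALL TRUNCATIONS OF ONE TORUS** (the hypothesis shape file A17 displays, RULING #9
ADDENDUM (2)(b)): if `SockB9P3Per P L B₀ B₀β cP β len η m′ {ℤ^{d+1}} torusLam torusLamb` holds for every `m′ ≤ k`, then for every `m′ ≤ k`, every
`0 < α₀ ≤ c_L` (`c_L ≤ cP`), every `SU(N)`-valued `P`-PERIODIC `U₀ ∈ 𝔄_{m′}`: `B9P3PerAt L B₀ B₀β c_B β len η m′ α₀ P U₀` (`c_B ≤ cP`) — EXACTLY the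
binder shape of the (B)-arrow of `B8Thm2TorusKnitCubeCore.hThm2_of_core` ∕ `B8Thm2TorusB9LineReduced.hThm2_of_core_three` (the `𝔄` clause is granted,
not used; the periodicity clause is USED). [cite: Balaban1985RegularSpaces, (1.59) p.86, Thm 2 p.83, p.77] -/
theorem b9Arrow_of_sockB9P3Per {N : ℕ} {P : ℕ} {L : ℕ} {B₀ B₀β cP cB cL β : ℝ} {len : LSite (d + 1) → ℝ} {η : ℝ} {k : ℕ}
    (hS : letI : CStarAlgebra (Matrix (Fin N) (Fin N) ℂ) := {}
      ∀ m', m' ≤ k → SockB9P3Per (𝔸 := Matrix (Fin N) (Fin N) ℂ) P L B₀ B₀β cP β len η m' (fun _ => (Set.univ : Set (LSite (d + 1))))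
        (fun m'' => torusLam (d := d + 1) m'') (fun m'' => torusLamb (d := d + 1) m''))
    (hcB : cB ≤ cP) (hcL : cL ≤ cP) :
    letI : CStarAlgebra (Matrix (Fin N) (Fin N) ℂ) := {}
    ∀ m', m' ≤ k → ∀ ⦃α₀ : ℝ⦄, 0 < α₀ → α₀ ≤ cL → ∀ U₀ : LSite (d + 1) → Fin (d + 1) → (Matrix (Fin N) (Fin N) ℂ)ˣ,
      (∀ x κ, U₀ x κ ∈ specialUnitaryUnits (Fin N)) →
      (∀ (x : LSite (d + 1)) (μ : Fin (d + 1)), U₀ (x + (P : ℤ) • e μ) = U₀ x) →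
      B8Ineq132.InAk L m' η α₀ (fun _ => (Set.univ : Set (LSite (d + 1)))) U₀ →
      B9P3PerAt (𝔸 := Matrix (Fin N) (Fin N) ℂ) L B₀ B₀β cB β len η m' α₀ (P : ℤ) U₀ := by
  letI : CStarAlgebra (Matrix (Fin N) (Fin N) ℂ) := {}
  intro m' hm' α₀ hα₀ hα₀c U₀ hU₀ hU₀p _
  exact b9P3PerAt_of_sockB9P3Per_su (hS m' hm') hU₀ hU₀p hα₀ (hα₀c.trans hcL) hcB

end OneDatum

/-! ## §2 From a family conclusion over all `ℤ^{d+1}` data (a datum-generic supplier's shape) -/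

section Family

variable {𝔸 : Type} [CStarAlgebra 𝔸]

/-- **A DATUM-GENERIC GUARDED SUPPLY FEEDS THE (B)-LINE**: if the guarded socket holds at EVERY `ℤ^{d+1}` datum and level for the period `P`, then for
every spacing `η > 0`, truncation `m`, `0 < α₀ ≤ cP` and every `P`-periodic unitary `U₀`: `B9P3PerAt L B₀ B₀β cB β len η m α₀ P U₀` (`cB ≤ cP`) — the
torus member is the datum `torusIdx hL ⟨η, _, max m 1, _⟩`. [cite: Balaban1985RegularSpaces, (1.59) p.86, Prop. 3 p.87, p.77] -/
theorem b9P3PerAt_of_sockB9P3Per_family {P : ℕ} {L : ℕ} (hL : 1 ≤ L) {B₀ B₀β cP cB β : ℝ} {len : LSite (d + 1) → ℝ}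
    (hS : ∀ (i : ZdIdx (d + 1) L) (m : ℕ), m ≤ i.k → SockB9P3Per (𝔸 := 𝔸) P L B₀ B₀β cP β len i.η m i.Ω i.Λs i.Λb)
    (hcB : cB ≤ cP) {η : ℝ} (hη : 0 < η) (m : ℕ) {α₀ : ℝ} (hα₀ : 0 < α₀) (hα₀c : α₀ ≤ cP)
    {U₀ : LSite (d + 1) → Fin (d + 1) → 𝔸ˣ} (hU₀ : ∀ x κ, U₀ x κ ∈ unitaryUnits 𝔸)
    (hU₀p : ∀ (z : LSite (d + 1)) (i : Fin (d + 1)), U₀ (z + (P : ℤ) • e i) = U₀ z) :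
    B9P3PerAt (𝔸 := 𝔸) L B₀ B₀β cB β len η m α₀ (P : ℤ) U₀ :=
  b9P3PerAt_of_sockB9P3Per_torusIdx hL ⟨η, hη, max m 1, le_max_right _ _⟩
    (hS (torusIdx (d := d + 1) hL ⟨η, hη, max m 1, le_max_right _ _⟩) m (le_max_left _ _)) hU₀ hU₀p hα₀ hα₀c hcB

/-- ★ **THE (B)-ARROW OF `hThm2_of_core` FROM A DATUM-GENERIC GUARDED SUPPLY**, in the EXACT binder shape of the endpoint (all truncations `m′ ≤ k`, radius
`c_L ≤ cP`, `SU(N)`-valued `P`-periodic backgrounds in `𝔄_{m′}` — periodicity USED, the `𝔄` clause granted). [cite: Balaban1985RegularSpaces, (1.59) p.86, Thm 2 p.83, p.77] -/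
theorem b9Arrow_of_sockB9P3Per_family {N : ℕ} {P : ℕ} {L : ℕ} (hL : 1 ≤ L) {B₀ B₀β cP cB cL β : ℝ} {len : LSite (d + 1) → ℝ}
    (hS : letI : CStarAlgebra (Matrix (Fin N) (Fin N) ℂ) := {}
      ∀ (i : ZdIdx (d + 1) L) (m : ℕ), m ≤ i.k →
        SockB9P3Per (𝔸 := Matrix (Fin N) (Fin N) ℂ) P L B₀ B₀β cP β len i.η m i.Ω i.Λs i.Λb)
    (hcB : cB ≤ cP) (hcL : cL ≤ cP) {η : ℝ} (hη : 0 < η) (k : ℕ) :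
    letI : CStarAlgebra (Matrix (Fin N) (Fin N) ℂ) := {}
    ∀ m', m' ≤ k → ∀ ⦃α₀ : ℝ⦄, 0 < α₀ → α₀ ≤ cL → ∀ U₀ : LSite (d + 1) → Fin (d + 1) → (Matrix (Fin N) (Fin N) ℂ)ˣ,
      (∀ x κ, U₀ x κ ∈ specialUnitaryUnits (Fin N)) →
      (∀ (x : LSite (d + 1)) (μ : Fin (d + 1)), U₀ (x + (P : ℤ) • e μ) = U₀ x) →
      B8Ineq132.InAk L m' η α₀ (fun _ => (Set.univ : Set (LSite (d + 1)))) U₀ →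
      B9P3PerAt (𝔸 := Matrix (Fin N) (Fin N) ℂ) L B₀ B₀β cB β len η m' α₀ (P : ℤ) U₀ := by
  letI : CStarAlgebra (Matrix (Fin N) (Fin N) ℂ) := {}
  intro m' _ α₀ hα₀ hα₀c U₀ hU₀ hU₀p _
  exact b9P3PerAt_of_sockB9P3Per_family hL hS hcB hη m' hα₀ (hα₀c.trans hcL)
    (fun x κ => specialUnitaryUnits_le_unitaryUnits (hU₀ x κ)) hU₀p

end Family

/-! ## §3 Corollary: the UNGUARDED socket feeds the guarded arrow (consumers of p637562 lose nothing) -/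

section Unguarded

variable {𝔸 : Type} [CStarAlgebra 𝔸]

/-- The unguarded socket `SockB9P3` at the torus datum gives the (B)-line at every `P`-periodic unitary background through the guarded road
(`sockB9P3Per_of_sockB9P3`, then §1) — the same conclusion as p637562's `b9P3PerAt_of_sockB9P3` at `(P : ℤ)`, recorded so that both editions of the
socket are interchangeable for the knit. [cite: Balaban1985RegularSpaces, (1.59) p.86, p.77] -/
theorem b9P3PerAt_of_sockB9P3_per {P : ℕ} {L : ℕ} {B₀ B₀β cP cB β : ℝ} {len : LSite (d + 1) → ℝ} {η : ℝ} {m : ℕ} {α₀ : ℝ}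
    {U₀ : LSite (d + 1) → Fin (d + 1) → 𝔸ˣ}
    (hS : SockB9P3 (𝔸 := 𝔸) L B₀ B₀β cP β len η m (fun _ => (Set.univ : Set (LSite (d + 1))))
      (fun m' => torusLam (d := d + 1) m') (fun m' => torusLamb (d := d + 1) m'))
    (hU₀ : ∀ x κ, U₀ x κ ∈ unitaryUnits 𝔸) (hU₀p : ∀ (z : LSite (d + 1)) (i : Fin (d + 1)), U₀ (z + (P : ℤ) • e i) = U₀ z)
    (hα₀ : 0 < α₀) (hα₀c : α₀ ≤ cP) (hcB : cB ≤ cP) :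
    B9P3PerAt (𝔸 := 𝔸) L B₀ B₀β cB β len η m α₀ (P : ℤ) U₀ :=
  b9P3PerAt_of_sockB9P3Per (sockB9P3Per_of_sockB9P3 P hS) hU₀ hU₀p hα₀ hα₀c hcB

end Unguarded

end Literature.MathematicalPhysics.QuantumFieldTheory.Balaban1983to89.B8Eq159TorusPerOfSockB9P3Per
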